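import Summits.ValiantsHypothesis.ValiantsHypothesis.Theorems.RigidityForcesSymmetryGrenetFirstOrderRankRigidBorderShape

/-!
# Route RigidityForcesSymmetry — `GrenetFirstOrderRankRigid` (item stmt-ValiantsHypothesis-21029),
line `grenet_gauge`: stub `stub_linearRigid`, step 5 (block II, bottom border) — the head entries of a
pair `(S, ∅)`

For the crux line `Cruxes/GrenetFirstOrderRankRigid/Lines/grenet_gauge.lean` (blueprint
`Lines/grenet_gauge-stub_linearRigid-PROOF.md`, §5, block II, border `k = 0`; binder `hH0` of
`grenet_linearRigid_of_blockII`, `…FinalModuloII`).  Mirror image of `…BorderTu`: the head entries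
`κ_y := (A'_(y, 0)) (row S) (col {y})`, `y : Fin n`, of a homogeneous, rank-constrained tangent direction
at Grenet's pencil form one torus-weight block (row weight `1 + 1_S`, column weight `1 + 1_{[0, |S|)}`);
the rank constraint leaves no other entry in it (`border_column_shape_bot`).  For `x ∉ S` and `p' ∈ S`
evaluate the block at the permutation point of an ordering `π` listing `x` first, then `S - p'`, then
`Sᶜ - x + p'`, with the EXTRA CELL `(p', 0)` (`evalPermExtra_grenet_W`, val-width-21029-p2): only `κ_x`
(through `W ∅ S · x_{x,0} · W {x} univ`, the path `∅ → S` starting through the extra cell) and `κ_{p'}`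
(through `per_n · x_{p',0} · W {p'} S`) survive, with opposite signs: `κ_{p'} = κ_x`
(`grenet_borderH0_core`).

No new definitions.  VP ≠ VNP is not moved by this file.
-/

noncomputable section

open MvPolynomial Matrix Finset

namespace Summit.ValiantsHypothesis.Theorems.RigidityForcesSymmetry.GrenetGauge

open Literature.Computability.AlgebraicComplexity

section BorderH0

variable {k : Type*} [CommRing k] [IsDomain k] {n N : ℕ} (e : Finset (Fin n) ≃ Fin (N + 1))

/-- **Two head entries of a pair `(S, ∅)` across `S`.**  For `S = R i`, `x ∉ S`, `p' ∈ S`, columns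
`C j₁ = {x}`, `C j₂ = {p'}` and the bottom level `c0 = 0`: `A'_(p', c0) i j₂ = A'_(x, c0) i j₁` (evaluate
the weight block of the head entry `(i, j₁, (x, c0))` at the permutation-with-extra-cell point described
in the module docstring). [cite: Grenet2011, Thm. 1] -/
theorem grenet_borderH0_core (hn : n ≠ 0) (hN : 2 ^ n = N + 1)
    (A' : Fin n × Fin n → Matrix (Fin N) (Fin N) k)
    (htr : ((Grenet.repr k n e).adjugate * ∑ v, (X v : MvPolynomial (Fin n × Fin n) k) • (A' v).map C).trace = 0)
    (hsupp : ∀ (w : Fin n × Fin n) (a b : Fin N), A' w a b ≠ 0 →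
      (w.1 ∉ e.symm ((e univ).succAbove a) ∧ (w.2 : ℕ) = (e.symm ((e univ).succAbove a)).card) ∨
      (w.1 ∈ e.symm ((e ∅).succAbove b) ∧ (e.symm ((e ∅).succAbove b)).card = (w.2 : ℕ) + 1))
    {i j₁ j₂ : Fin N} {x p' c0 : Fin n} (hx : x ∉ e.symm ((e univ).succAbove i))
    (hp' : p' ∈ e.symm ((e univ).succAbove i)) (hj₁ : e.symm ((e ∅).succAbove j₁) = {x})
    (hj₂ : e.symm ((e ∅).succAbove j₂) = {p'}) (hc0 : (c0 : ℕ) = 0) :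
    A' (p', c0) i j₂ = A' (x, c0) i j₁ := by
  classical
  set S := e.symm ((e univ).succAbove i) with hSdef
  set T := e.symm ((e ∅).succAbove j₁) with hTdef
  have hRinj : ∀ a b : Fin N, e.symm ((e univ).succAbove a) = e.symm ((e univ).succAbove b) → a = b :=
    fun a b h => Fin.succAbove_right_injective (e.symm.injective h)
  have hCinj : ∀ a b : Fin N, e.symm ((e ∅).succAbove a) = e.symm ((e ∅).succAbove b) → a = b :=
    fun a b h => Fin.succAbove_right_injective (e.symm.injective h)
  have hxp : x ≠ p' := fun h => hx (h ▸ hp')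
  have hSpos : 1 ≤ S.card := Finset.card_pos.mpr ⟨p', hp'⟩
  have hSn : S.card < n := by
    rw [hSdef]
    have := (Finset.card_lt_iff_ne_univ _).mpr (grenet_row_ne_univ e i)
    rwa [Fintype.card_fin] at this
  have hTcard : T.card = 1 := by rw [hj₁, Finset.card_singleton]
  -- the ordering `π`: `x` first, then `S - p'`, then `Sᶜ - x + p'`; the extra cell is `(p', 0)`
  set L := insert x (S.erase p') with hL
  have hLcard : L.card = S.card := by
    rw [hL, Finset.card_insert_of_notMem (fun h => hx (Finset.mem_of_mem_erase h)), Finset.card_erase_of_mem hp']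
    omega
  obtain ⟨π, hπL, hπx⟩ := exists_perm_prefix_first L x (by rw [hL]; exact Finset.mem_insert_self _ _)
  rw [hLcard] at hπL
  have hπc0 : π c0 = x := hπx c0 hc0
  set c₁ := π.symm p' with hc₁
  have hπc₁ : π c₁ = p' := Equiv.apply_symm_apply π p'
  have hmemL : ∀ y : Fin n, ((π.symm y : Fin n) : ℕ) < S.card ↔ y ∈ L := fun y => by
    rw [← Grenet.mem_prefix_image π, hπL]
  have hpos0 : ∀ y : Fin n, ((π.symm y : Fin n) : ℕ) = 0 ↔ y = x := fun y => by
    constructor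
    · intro h; rw [← Equiv.apply_symm_apply π y]; exact hπx _ h
    · intro h; rw [h, ← hπc0, Equiv.symm_apply_apply]; exact hc0
  have hc₁k : S.card ≤ (c₁ : ℕ) := by
    by_contra hlt
    have : p' ∈ L := (hmemL p').mp (not_le.mp hlt)
    rw [hL, Finset.mem_insert] at this
    rcases this with h | h
    · exact hxp h.symm
    · exact Finset.notMem_erase p' S h
  have hc₀₁ : c0 ≠ c₁ := fun h => hxp (by rw [← hπc0, h, hπc₁])
  -- the slices of `π`
  have hslice1 : (univ.filter fun c : Fin n => (∅ : Finset (Fin n)).card ≤ (c : ℕ) ∧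
      (c : ℕ) < (univ : Finset (Fin n)).card).image π = univ := by
    apply Finset.eq_univ_of_forall
    intro y
    rw [mem_permSlice, Finset.card_empty, Finset.card_univ, Fintype.card_fin]
    exact ⟨Nat.zero_le _, (π.symm y).isLt⟩
  have hsliceS : (univ.filter fun c : Fin n => (∅ : Finset (Fin n)).card ≤ (c : ℕ) ∧
      (c : ℕ) < S.card).image π = L := by
    rw [Finset.card_empty, permSlice_zero, hπL]
  have hsliceU : ∀ y : Fin n, (univ.filter fun c : Fin n => ({y} : Finset (Fin n)).card ≤ (c : ℕ) ∧
      (c : ℕ) < (univ : Finset (Fin n)).card).image π = univ.erase x := by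
    intro y
    ext z
    rw [mem_permSlice, Finset.card_singleton, Finset.card_univ, Fintype.card_fin, Finset.mem_erase]
    have h1 := hpos0 z
    have h2 := (π.symm z).isLt
    constructor
    · intro h; exact ⟨fun h' => by have := h1.mpr h'; omega, Finset.mem_univ _⟩
    · intro h; refine ⟨?_, h2⟩
      by_contra h'
      exact h.1 (h1.mp (by omega))
  have hsliceSY : ∀ y : Fin n, (univ.filter fun c : Fin n => ({y} : Finset (Fin n)).card ≤ (c : ℕ) ∧
      (c : ℕ) < S.card).image π = S.erase p' := by
    intro y
    ext z
    rw [mem_permSlice, Finset.card_singleton, Finset.mem_erase]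
    have h1 := hpos0 z
    have h2 := hmemL z
    rw [hL, Finset.mem_insert, Finset.mem_erase] at h2
    constructor
    · rintro ⟨ha, hb⟩
      have hzx : z ≠ x := fun h' => by have := h1.mpr h'; omega
      rcases h2.mp hb with h' | h'
      · exact absurd h' hzx
      · exact h'
    · rintro ⟨hzp, hzS⟩
      have hzx : z ≠ x := fun h' => hx (h' ▸ hzS)
      refine ⟨?_, h2.mpr (Or.inr ⟨hzp, hzS⟩)⟩
      by_contra h'
      exact hzx (h1.mp (by omega))
  -- the four evaluations at the point
  have hc0y : ∀ y : Fin n, ¬ (({y} : Finset (Fin n)).card ≤ (c0 : ℕ)) := fun y => by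
    rw [Finset.card_singleton]; omega
  have hEper : eval (fun v : Fin n × Fin n => if π v.2 = v.1 ∨ (v.2 = c0 ∧ v.1 = π c₁) then (1 : k) else 0)
      (perPoly (Fin n) k) = 1 := by
    rw [← grenet_W_empty_univ, evalPermExtra_grenet_W k π c0 c₁ hc₀₁ ∅ univ (by simp), hslice1]
    have h1 : ¬ ¬ ((∅ : Finset (Fin n)).card ≤ (c₁ : ℕ) ∧ (c₁ : ℕ) < (univ : Finset (Fin n)).card) := fun h =>
      h ⟨by simp, by rw [Finset.card_univ, Fintype.card_fin]; exact c₁.isLt⟩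
    simp only [h1, false_and, and_false, reduceIte, add_zero]
    exact if_pos ⟨Finset.disjoint_empty_left _, Finset.empty_union _⟩
  have hES : eval (fun v : Fin n × Fin n => if π v.2 = v.1 ∨ (v.2 = c0 ∧ v.1 = π c₁) then (1 : k) else 0)
      ((1 - Grenet.adj k n).adjugate ∅ S) = 1 := by
    have hxSe : x ∉ S.erase p' := fun h => hx (Finset.mem_of_mem_erase h)
    rw [evalPermExtra_grenet_W k π c0 c₁ hc₀₁ ∅ S (by simp), hsliceS, hπc₁, hπc0, hL,
      Finset.erase_insert hxSe, Finset.insert_erase hp',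
      if_neg (fun h => hx (by rw [← h.2, Finset.empty_union]; exact Finset.mem_insert_self _ _)), zero_add]
    refine if_pos ⟨by rw [Finset.card_empty]; omega, by omega, fun h => by omega,
      Finset.disjoint_empty_left _, Finset.empty_union _⟩
  have hEU : ∀ y : Fin n, eval (fun v : Fin n × Fin n => if π v.2 = v.1 ∨ (v.2 = c0 ∧ v.1 = π c₁) then (1 : k) else 0)
      ((1 - Grenet.adj k n).adjugate {y} univ) = if y = x then 1 else 0 := by
    intro y
    rw [evalPermExtra_grenet_W k π c0 c₁ hc₀₁ {y} univ (Finset.card_le_card (Finset.subset_univ _)), hsliceU y]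
    simp only [hc0y y, false_and, reduceIte, add_zero]
    by_cases hy : y = x
    · rw [if_pos hy, if_pos ⟨Finset.disjoint_singleton_left.mpr (by rw [hy]; exact Finset.notMem_erase _ _),
        by rw [hy, ← Finset.insert_eq, Finset.insert_erase (Finset.mem_univ _)]⟩]
    · rw [if_neg hy, if_neg]
      rintro ⟨h, -⟩
      exact Finset.disjoint_singleton_left.mp h (Finset.mem_erase.mpr ⟨hy, Finset.mem_univ _⟩)
  have hESY : ∀ y : Fin n, eval (fun v : Fin n × Fin n => if π v.2 = v.1 ∨ (v.2 = c0 ∧ v.1 = π c₁) then (1 : k) else 0)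
      ((1 - Grenet.adj k n).adjugate {y} S) = if y = p' then 1 else 0 := by
    intro y
    rw [evalPermExtra_grenet_W k π c0 c₁ hc₀₁ {y} S (by rw [Finset.card_singleton]; exact hSpos), hsliceSY y]
    simp only [hc0y y, false_and, reduceIte, add_zero]
    by_cases hy : y = p'
    · rw [if_pos hy, if_pos ⟨Finset.disjoint_singleton_left.mpr (by rw [hy]; exact Finset.notMem_erase _ _),
        by rw [hy, ← Finset.insert_eq, Finset.insert_erase hp']⟩]
    · rw [if_neg hy, if_neg]
      rintro ⟨-, h⟩
      have : p' ∈ {y} ∪ S.erase p' := by rw [h]; exact hp'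
      rw [Finset.mem_union, Finset.mem_singleton] at this
      rcases this with h' | h'
      · exact hy h'.symm
      · exact Finset.notMem_erase p' S h'
  -- the two entries as variables (keeps the weight expressions in pattern form)
  obtain ⟨v₀, hv₀⟩ : ∃ v₀ : Fin n × Fin n, v₀ = (x, c0) := ⟨_, rfl⟩
  obtain ⟨v₁, hv₁⟩ : ∃ v₁ : Fin n × Fin n, v₁ = (p', c0) := ⟨_, rfl⟩
  have hv₀1 : v₀.1 = x := by rw [hv₀]
  have hv₀2 : v₀.2 = c0 := by rw [hv₀]
  have hv₁1 : v₁.1 = p' := by rw [hv₁]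
  have hv₁2 : v₁.2 = c0 := by rw [hv₁]
  rw [← hv₀, ← hv₁]
  -- the weight block of the head entry `(i, j₁, v₀)`, evaluated at the point
  have hblock := grenet_tangency_weightSplit e (fun j => (Pi.single (Sum.inl j) 1 : Fin n ⊕ Fin n → ℕ))
    (fun c => (Pi.single (Sum.inr c) 1 : Fin n ⊕ Fin n → ℕ)) hn hN A' htr
    ((∑ j₁ ∈ S, (Pi.single (Sum.inl j₁) 1 : Fin n ⊕ Fin n → ℕ)
        + ∑ j₁ ∈ Tᶜ, (Pi.single (Sum.inl j₁) 1 : Fin n ⊕ Fin n → ℕ)) +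
      (∑ c ∈ univ.filter (fun c : Fin n => (c : ℕ) < S.card), (Pi.single (Sum.inr c) 1 : Fin n ⊕ Fin n → ℕ)
        + ∑ c ∈ univ.filter (fun c : Fin n => T.card ≤ (c : ℕ)), (Pi.single (Sum.inr c) 1 : Fin n ⊕ Fin n → ℕ))
      + ((Pi.single (Sum.inl v₀.1) 1 : Fin n ⊕ Fin n → ℕ) + (Pi.single (Sum.inr v₀.2) 1 : Fin n ⊕ Fin n → ℕ)))
  have h := congrArg (eval (fun v : Fin n × Fin n => if π v.2 = v.1 ∨ (v.2 = c0 ∧ v.1 = π c₁) then (1 : k) else 0)) hblock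
  rw [map_sum, map_zero] at h
  have hterm : ∀ z ∈ (univ : Finset (Fin N × Fin N × (Fin n × Fin n))).filter (fun z =>
      ((∑ j₁ ∈ e.symm ((e univ).succAbove z.1), (Pi.single (Sum.inl j₁) 1 : Fin n ⊕ Fin n → ℕ)
          + ∑ j₁ ∈ (e.symm ((e ∅).succAbove z.2.1))ᶜ, (Pi.single (Sum.inl j₁) 1 : Fin n ⊕ Fin n → ℕ)) +
        (∑ c ∈ univ.filter (fun c : Fin n => (c : ℕ) < (e.symm ((e univ).succAbove z.1)).card),
            (Pi.single (Sum.inr c) 1 : Fin n ⊕ Fin n → ℕ)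
          + ∑ c ∈ univ.filter (fun c : Fin n => (e.symm ((e ∅).succAbove z.2.1)).card ≤ (c : ℕ)),
            (Pi.single (Sum.inr c) 1 : Fin n ⊕ Fin n → ℕ))
        + ((Pi.single (Sum.inl z.2.2.1) 1 : Fin n ⊕ Fin n → ℕ) + (Pi.single (Sum.inr z.2.2.2) 1 : Fin n ⊕ Fin n → ℕ)))
      = ((∑ j₁ ∈ S, (Pi.single (Sum.inl j₁) 1 : Fin n ⊕ Fin n → ℕ)
          + ∑ j₁ ∈ Tᶜ, (Pi.single (Sum.inl j₁) 1 : Fin n ⊕ Fin n → ℕ)) +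
        (∑ c ∈ univ.filter (fun c : Fin n => (c : ℕ) < S.card), (Pi.single (Sum.inr c) 1 : Fin n ⊕ Fin n → ℕ)
          + ∑ c ∈ univ.filter (fun c : Fin n => T.card ≤ (c : ℕ)), (Pi.single (Sum.inr c) 1 : Fin n ⊕ Fin n → ℕ))
        + ((Pi.single (Sum.inl v₀.1) 1 : Fin n ⊕ Fin n → ℕ) + (Pi.single (Sum.inr v₀.2) 1 : Fin n ⊕ Fin n → ℕ)))),
      eval (fun v : Fin n × Fin n => if π v.2 = v.1 ∨ (v.2 = c0 ∧ v.1 = π c₁) then (1 : k) else 0)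
        (C (A' z.2.2 z.1 z.2.1) *
          (perPoly (Fin n) k * (1 - Grenet.adj k n).adjugate (e.symm ((e ∅).succAbove z.2.1))
              (e.symm ((e univ).succAbove z.1)) * X z.2.2
            - (1 - Grenet.adj k n).adjugate ∅ (e.symm ((e univ).succAbove z.1)) * X z.2.2
              * (1 - Grenet.adj k n).adjugate (e.symm ((e ∅).succAbove z.2.1)) univ))
        = A' z.2.2 z.1 z.2.1 * ((if z = (i, j₂, v₁) then 1 else 0) - (if z = (i, j₁, v₀) then 1 else 0)) := by
    rintro ⟨i'', j'', v''⟩ hz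
    have hw := (Finset.mem_filter.mp hz).2
    simp only at hw ⊢
    set S'' := e.symm ((e univ).succAbove i'') with hS''def
    set T'' := e.symm ((e ∅).succAbove j'') with hT''def
    by_cases hA0 : A' v'' i'' j'' = 0
    · rw [hA0, map_mul, eval_C, zero_mul, zero_mul]
    -- the shape of the entry: a head entry `(S, {y}, (y, 0))`
    have hcol : ∀ c, c < n → (if c < S''.card then 1 else 0) + (if T''.card ≤ c then 1 else 0)
        + (if c = (v''.2 : ℕ) then 1 else 0)
        = (if c < S.card then 1 else 0) + (if 1 ≤ c then 1 else 0) + (if c = 0 then (1 : ℕ) else 0) := by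
      intro c hc
      have h1 := congrFun hw (Sum.inr ⟨c, hc⟩)
      rw [weightE_apply_inr, weightE_apply_inr, ite_fin_eq_eq_ite_val_eq, ite_fin_eq_eq_ite_val_eq, hv₀2, hc0,
        hTcard] at h1
      exact h1
    have hrow : ∀ y : Fin n, (if y ∈ S'' then 1 else 0) + (if y ∈ T'' then 0 else 1)
        + (if y = v''.1 then 1 else 0)
        = (if y ∈ S then 1 else 0) + (if y ∈ T then 0 else 1) + (if y = x then (1 : ℕ) else 0) := by
      intro y
      have h1 := congrFun hw (Sum.inl y)
      rwa [weightE_apply_inl, weightE_apply_inl, hv₀1] at h1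
    have hth : (v''.1 ∉ S'' ∧ (v''.2 : ℕ) = S''.card) ∨ (v''.1 ∈ T'' ∧ T''.card = (v''.2 : ℕ) + 1) := by
      rw [hS''def, hT''def]; exact hsupp v'' i'' j'' hA0
    have hS''n : S''.card < n := by
      rw [hS''def]
      have := (Finset.card_lt_iff_ne_univ _).mpr (grenet_row_ne_univ e i'')
      rwa [Fintype.card_fin] at this
    have hT''pos : 1 ≤ T''.card := Finset.card_pos.mpr (Finset.nonempty_iff_ne_empty.mpr (grenet_col_ne_empty e j''))
    obtain ⟨hs, ht, hqq⟩ := border_column_shape_bot hSpos hSn hT''pos hS''n hcol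
      (hth.imp (fun h' => h'.2) (fun h' => h'.2))
    have hhd : v''.1 ∈ T'' := by
      rcases hth with h' | h'
      · exfalso; omega
      · exact h'.1
    have hT''eq : T'' = {v''.1} := by
      obtain ⟨z, hz⟩ := Finset.card_eq_one.mp ht
      rw [hz] at hhd ⊢
      rw [Finset.mem_singleton.mp hhd]
    have hS''S : S'' = S := by
      ext y
      have h1 := hrow y
      rw [hT''eq, hj₁] at h1
      have e1 : (if y ∈ ({v''.1} : Finset (Fin n)) then 0 else 1) + (if y = v''.1 then 1 else 0) = (1 : ℕ) := by
        by_cases h' : y = v''.1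
        · rw [if_pos (Finset.mem_singleton.mpr h'), if_pos h']
        · rw [if_neg (fun h => h' (Finset.mem_singleton.mp h)), if_neg h']
      have e2 : (if y ∈ ({x} : Finset (Fin n)) then 0 else 1) + (if y = x then 1 else 0) = (1 : ℕ) := by
        by_cases h' : y = x
        · rw [if_pos (Finset.mem_singleton.mpr h'), if_pos h']
        · rw [if_neg (fun h => h' (Finset.mem_singleton.mp h)), if_neg h']
      by_cases h2 : y ∈ S'' <;> by_cases h3 : y ∈ S
      · exact ⟨fun _ => h3, fun _ => h2⟩
      · rw [if_pos h2, if_neg h3] at h1; omega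
      · rw [if_neg h2, if_pos h3] at h1; omega
      · exact ⟨fun h' => absurd h' h2, fun h' => absurd h' h3⟩
    have hi'' : i'' = i := hRinj _ _ (by rw [← hS''def, ← hSdef]; exact hS''S)
    have hv2 : v''.2 = c0 := Fin.ext (by rw [hqq, hc0])
    have hvv : v'' = (v''.1, c0) := Prod.ext rfl hv2
    -- no path `{y} → S` unless `y ∈ S`: handled by the closed formula `hESY`; evaluate
    rw [hv₀, hv₁, map_mul, eval_C, map_sub, map_mul, map_mul, map_mul, map_mul, eval_X, hT''eq, hS''S, hEper, hES,
      hEU, hESY, hvv, one_mul, one_mul, hi'']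
    simp only [hπc0, hπc₁, true_and]
    by_cases hyp : v''.1 = p'
    · have hj : j'' = j₂ := hCinj _ _ (by rw [← hT''def, hT''eq, hyp, hj₂])
      have hyx : ¬ v''.1 = x := fun h' => hxp (h'.symm.trans hyp)
      rw [if_pos hyp, if_pos (Or.inr hyp), if_neg hyx, hj, hyp, if_pos rfl,
        if_neg (fun h' => hxp (by have := congrArg (fun z => z.2.2.1) h'; exact this.symm))]
      ring
    · by_cases hyx : v''.1 = x
      · have hj : j'' = j₁ := hCinj _ _ (by rw [← hT''def, hT''eq, hyx, ← hTdef, hj₁])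
        rw [if_neg hyp, if_pos (Or.inl hyx.symm), if_pos hyx, hj, hyx,
          if_neg (fun h' => hxp (by have := congrArg (fun z => z.2.2.1) h'; exact this)), if_pos rfl]
        ring
      · rw [if_neg hyp, if_neg (fun h' => h'.elim (fun h'' => hyx h''.symm) hyp), if_neg hyx,
          if_neg (fun h' => hyp (by have := congrArg (fun z => z.2.2.1) h'; exact this)),
          if_neg (fun h' => hyx (by have := congrArg (fun z => z.2.2.1) h'; exact this))]
        ring
  rw [Finset.sum_congr rfl hterm] at h
  -- the two surviving entries
  have hxt : ((i, j₁, v₀) : Fin N × Fin N × (Fin n × Fin n)) ∈ (univ : Finset (Fin N × Fin N × (Fin n × Fin n))).filter (fun z =>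
      ((∑ j₁ ∈ e.symm ((e univ).succAbove z.1), (Pi.single (Sum.inl j₁) 1 : Fin n ⊕ Fin n → ℕ)
          + ∑ j₁ ∈ (e.symm ((e ∅).succAbove z.2.1))ᶜ, (Pi.single (Sum.inl j₁) 1 : Fin n ⊕ Fin n → ℕ)) +
        (∑ c ∈ univ.filter (fun c : Fin n => (c : ℕ) < (e.symm ((e univ).succAbove z.1)).card),
            (Pi.single (Sum.inr c) 1 : Fin n ⊕ Fin n → ℕ)
          + ∑ c ∈ univ.filter (fun c : Fin n => (e.symm ((e ∅).succAbove z.2.1)).card ≤ (c : ℕ)),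
            (Pi.single (Sum.inr c) 1 : Fin n ⊕ Fin n → ℕ))
        + ((Pi.single (Sum.inl z.2.2.1) 1 : Fin n ⊕ Fin n → ℕ) + (Pi.single (Sum.inr z.2.2.2) 1 : Fin n ⊕ Fin n → ℕ)))
      = ((∑ j₁ ∈ S, (Pi.single (Sum.inl j₁) 1 : Fin n ⊕ Fin n → ℕ)
          + ∑ j₁ ∈ Tᶜ, (Pi.single (Sum.inl j₁) 1 : Fin n ⊕ Fin n → ℕ)) +
        (∑ c ∈ univ.filter (fun c : Fin n => (c : ℕ) < S.card), (Pi.single (Sum.inr c) 1 : Fin n ⊕ Fin n → ℕ)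
          + ∑ c ∈ univ.filter (fun c : Fin n => T.card ≤ (c : ℕ)), (Pi.single (Sum.inr c) 1 : Fin n ⊕ Fin n → ℕ))
        + ((Pi.single (Sum.inl v₀.1) 1 : Fin n ⊕ Fin n → ℕ) + (Pi.single (Sum.inr v₀.2) 1 : Fin n ⊕ Fin n → ℕ)))) :=
    Finset.mem_filter.mpr ⟨Finset.mem_univ _, rfl⟩
  have hxh : ((i, j₂, v₁) : Fin N × Fin N × (Fin n × Fin n)) ∈ (univ : Finset (Fin N × Fin N × (Fin n × Fin n))).filter (fun z =>
      ((∑ j₁ ∈ e.symm ((e univ).succAbove z.1), (Pi.single (Sum.inl j₁) 1 : Fin n ⊕ Fin n → ℕ)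
          + ∑ j₁ ∈ (e.symm ((e ∅).succAbove z.2.1))ᶜ, (Pi.single (Sum.inl j₁) 1 : Fin n ⊕ Fin n → ℕ)) +
        (∑ c ∈ univ.filter (fun c : Fin n => (c : ℕ) < (e.symm ((e univ).succAbove z.1)).card),
            (Pi.single (Sum.inr c) 1 : Fin n ⊕ Fin n → ℕ)
          + ∑ c ∈ univ.filter (fun c : Fin n => (e.symm ((e ∅).succAbove z.2.1)).card ≤ (c : ℕ)),
            (Pi.single (Sum.inr c) 1 : Fin n ⊕ Fin n → ℕ))
        + ((Pi.single (Sum.inl z.2.2.1) 1 : Fin n ⊕ Fin n → ℕ) + (Pi.single (Sum.inr z.2.2.2) 1 : Fin n ⊕ Fin n → ℕ)))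
      = ((∑ j₁ ∈ S, (Pi.single (Sum.inl j₁) 1 : Fin n ⊕ Fin n → ℕ)
          + ∑ j₁ ∈ Tᶜ, (Pi.single (Sum.inl j₁) 1 : Fin n ⊕ Fin n → ℕ)) +
        (∑ c ∈ univ.filter (fun c : Fin n => (c : ℕ) < S.card), (Pi.single (Sum.inr c) 1 : Fin n ⊕ Fin n → ℕ)
          + ∑ c ∈ univ.filter (fun c : Fin n => T.card ≤ (c : ℕ)), (Pi.single (Sum.inr c) 1 : Fin n ⊕ Fin n → ℕ))
        + ((Pi.single (Sum.inl v₀.1) 1 : Fin n ⊕ Fin n → ℕ) + (Pi.single (Sum.inr v₀.2) 1 : Fin n ⊕ Fin n → ℕ)))) := by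
    refine Finset.mem_filter.mpr ⟨Finset.mem_univ _, ?_⟩
    simp only
    funext z
    cases z with
    | inl y =>
      rw [weightE_apply_inl, weightE_apply_inl, hj₂, hv₁1, hv₀1, ← hSdef, hj₁]
      by_cases h1 : y = p' <;> by_cases h2 : y = x
      · exact absurd (h2.symm.trans h1) hxp
      · rw [if_pos (Finset.mem_singleton.mpr h1), if_pos h1,
          if_neg (fun h => h2 (Finset.mem_singleton.mp h)), if_neg h2]
      · rw [if_neg (fun h => h1 (Finset.mem_singleton.mp h)), if_neg h1,
          if_pos (Finset.mem_singleton.mpr h2), if_pos h2]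
      · rw [if_neg (fun h => h1 (Finset.mem_singleton.mp h)), if_neg h1,
          if_neg (fun h => h2 (Finset.mem_singleton.mp h)), if_neg h2]
    | inr c =>
      rw [weightE_apply_inr, weightE_apply_inr, hj₂, hv₁2, hv₀2, ← hSdef, hj₁, Finset.card_singleton,
        Finset.card_singleton]
  simp only [mul_sub, Finset.sum_sub_distrib, mul_ite, mul_one, mul_zero, Finset.sum_ite_eq' _ _,
    if_pos hxh, if_pos hxt] at h
  exact sub_eq_zero.mp h

end BorderH0

end Summit.ValiantsHypothesis.Theorems.RigidityForcesSymmetry.GrenetGauge
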